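import Literature.NumberTheory.EllipticCurves.LeadingTerm
import HarnessLib

/-!
# Skinner 2016, Theorem C: the `p`-part of the BSD formula in analytic rank `0` at a good ordinary
# or multiplicative prime `p ≥ 3`, under (irr) + (ram) only

Source: C. Skinner, *Multiplicative reduction and the cyclotomic main conjecture for* `GL₂`,
Pacific J. Math. 283 (2016), no. 1, 171–200, doi:10.2140/pjm.2016.283.171 (= arXiv:1407.1093),
§1, Theorem C (a special case of his Theorem B, itself a consequence of Theorem A = the cyclotomic
Iwasawa–Greenberg main conjecture for `p`-ordinary newforms of level `N` with `p ∣ N` allowed).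

This file states Theorem C as a NAMED FACT (`def … : Prop`, D-0014), in exactly the shape of the
tree's transcription of Skinner–Urban's Theorem 2 (a) (bsd.S30,
`Literature.NumberTheory.EllipticCurves.padicValRat_bsd_rank_zero`, file `LeadingTerm`), and
proves that it implies that older fact (`padicValRat_bsd_rank_zero_of_thmC`: Theorem C drops the
hypothesis "`ρ̄_{E,p}` surjective" and allows multiplicative reduction at `p`).

## Why a separate fact (what Theorem C adds at `p = 3`)

Skinner–Urban, Invent. Math. 195 (2014), print the integral main conjecture (Thm. 3.6.9, p. 45)
under "the image of `ρ_{E,p}` is surjective" (the `p`-ADIC representation; the hypothesis comes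
from Kato, Astérisque 295, Thm. 17.4 (3) via condition (12.5.2): the image of
`Gal(ℚ̄/ℚ(ζ_{p^∞}))` contains `SL₂(ℤ_p)`), while their Thm. 3.6.11 (a) = Thm. 2 (a) prints
"`ρ̄_{E,p}` surjective" (mod `p`). For `p ≥ 5` the two agree (Serre); for `p = 3` mod-`3`
surjectivity does not imply `3`-adic surjectivity (Elkies' curves, surjective mod `3` but not
mod `9`). Skinner 2016 removes the issue: footnote 1 (arXiv p. 2) "In order to conclude that the
equality holds in `Λ_𝒪` and not just `Λ_𝒪 ⊗_{ℤ_p} ℚ_p`, Theorem 1 in [SU-MCGL] requires that `ρ_f`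
have an `𝒪`-basis with respect to which the image contains `SL₂(ℤ_p)`. But as we explain in
Section 2.5, hypotheses (ii) and (iii) of Theorem A are enough for the arguments", and §2.5 (after
Theorem 9 = arXiv p. 10): "a closer reading of the proof of loc. cit. shows that all that is
necessary is that (a) `ρ̄_f` be irreducible and (b) there exist an element
`g ∈ Gal(ℚ̄/ℚ[μ_{p^∞}])` such that `T_f/(ρ_f(g)-1)T_f` is a free `𝒪`-module of rank one …
Hypothesis (b) is satisfied in light of hypothesis (iii) [`q ‖ N`, `q ≠ p`, `ρ̄_f` ramified at
`q`]: … `ρ_f(τ)` is unipotent for any `τ ∈ I_q` projecting to a topological generator of the tame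
quotient and, since `ρ̄_f` is ramified at `q`, `ρ̄_f(τ) ≠ 1`, hence `T_f/(ρ_f(τ)-1)T_f` is a free
`𝒪`-module of rank one. As `τ ∈ Gal(ℚ̄/ℚ[μ_{p^∞}])`, condition (b) holds for `g = τ`." The Euler
system input is Kato, Astérisque 295 (2004), Thm. 13.4 (3), printed for `p ≠ 2` under exactly
(a) + (b). Hence Theorem C holds as printed for every `p ≥ 3`, including `p = 3`, with NO image
hypothesis beyond irreducibility — this is the published text that retires the census caveats
`SU14@3` / `SK16-irr-only` of the rank-≤ 1 residual cell (class C1 at `p = 3`).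

Nothing is asserted: users take `(h : thmC_padicValRat_bsd_rank_zero)`; no `_holds` is expected
(Kato's Euler system and the Skinner–Urban Eisenstein-congruence divisibility are not in Mathlib or
the tree).

## References

* C. Skinner, Pacific J. Math. 283 (2016) 171–200, Thm. C, footnote 1, §2.5.
* C. Skinner, E. Urban, Invent. Math. 195 (2014), Thm. 2 (a) = Thm. 3.6.11 (a), Thm. 3.6.9.
* K. Kato, Astérisque 295 (2004), Thm. 12.5 (4) with (12.5.2), Thm. 13.4 (3), Thm. 17.4.
* D. Jetchev, C. Skinner, X. Wan, Camb. J. Math. 5 (2017), Thm. 7.2.1 ('Thm. 40' of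
  arXiv:1512.06894v1) (ii): the same statement, "good ordinary or multiplicative reduction at the
  odd prime `p`".
-/

noncomputable section

open scoped Classical

open WeierstrassCurve

namespace Literature.NumberTheory.EllipticCurves.Skinner2016

/-- **Skinner 2016, Theorem C** (Pacific J. Math. 283 (2016), §1; = arXiv:1407.1093 §1 Thm. C),
as printed: "Let `E` be an elliptic curve over `ℚ` with good ordinary or multiplicative reduction at
a prime `p ≥ 3`. Suppose that (i) `E[p]` is an irreducible `Gal(ℚ̄/ℚ)`-representation; (ii) there
exists a prime `q ≠ p` at which `E` has multiplicative reduction and `E[p]` is ramified. If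
`L(E,1) ≠ 0` then `|L(E,1)/Ω_E|_p^{-1} = |#Ш(E) ∏_ℓ c_ℓ(E)|_p^{-1}`, and if `L(E,1) = 0` then
`Sel_{p^∞}(E)` has `ℤ_p`-corank at least one." Only the first conclusion (`L(E,1) ≠ 0`) is
transcribed. Transcription, identical to bsd.S30 (`padicValRat_bsd_rank_zero`, Skinner–Urban
Thm. 2 (a)) except that the reduction hypothesis is "good ordinary (`hgood`, `hord : p ∤ a_p`) OR
multiplicative" (`hred`) and that NO surjectivity of `ρ̄_{E,p}` is assumed: `W` a globally minimal
model, `Ω_E = W.realPeriodRat` (Néron period incl. real components; `p` odd), (ii) via Tate's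
parametrisation (`E[p]` is ramified at a multiplicative `ℓ` iff `p ∤ v_ℓ(Δ_min)`), `hfin : Finite Ш`
(known from `hL` by Kato / Gross–Zagier–Kolyvagin, bsd.S20/S17) makes `W.shaOrder` the genuine
order with `ord_p #Ш(E) = ord_p #Ш(E)[p^∞]`, `W.tamagawaProduct = ∏_ℓ c_ℓ`, and the torsion term
`- 2·ord_p #E(ℚ)_tors` vanishes under (i) (`E(ℚ)[p] = 0` when `E[p]` is irreducible), so the
BSD-shaped right-hand side has the printed valuation. Integrality at `p = 3`: footnote 1 and §2.5
of the source (irreducibility + the ramified multiplicative prime replace Kato's `SL₂(ℤ_p)`-image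
hypothesis), see the module docstring.
PROOF-INPUT FLAG `SU14-12.3.6-mu@nonsplit@3` (a docstring flag priced by the referee desks on the
`p = 3` INSTANTIATION — NOT a statement change; the statement below is print's for every `3 ≤ p`,
and Skinner's own text is NOT the locus of the gap: the §2.5 integrality repair above rests on
Kato's printed Thm. 12.4 (3) / 13.4 (3); referee A R152.2, referee C2 R334.3 (β) / R337.3 (β)(γ) =
wording of record; ARM-P reader sheets D-AUDIT-r20-Sk16C `db467065daea6044` (this decl),
D-AUDIT-r03 `11b71c810fa7250e`, D-AUDIT-r04 `770d5e7dd36f5860`; cell bsd-stepL-plan's R-01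
answer). PRINT PROOF CHAIN: Thm. C "is just a special case of Theorem B" ⇐ Thm. A ⇐ (at `p ∤ N`)
Thm. 9 (= journal Thm. 2.5.2) = "[SU-MCGL] Thm. 1 … in combination with results of Kato"
[corpus:paper:arxiv-1407.1093 p0011:L9–L21], resp. (at `p ‖ N`, §3.1 [p0013:L11–L38]) the Hida
family of `f_E`, members `f_m` of level `M`, `p ∤ M`, whose "Iwasawa–Greenberg Main Conjecture …
holds by (a), (d), and Theorem (MCthm1)" — BOTH at the same `p` — ⟶ "The main results of [SU-MCGL]
show that for a suitable imaginary quadratic field `K` and a large enough set `Σ`, the equality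
`Ch(f)Ch(f ⊗ χ_K) = (𝓛_f 𝓛_{f⊗χ_K})` holds" [p0011:L55–L61] = Skinner–Urban's three-variable main
conjecture ⟶ S–U Prop. 13.4.1 (ii) "follows from part (i) and Proposition 12.3.6"
[corpus:paper:doi-10-1007-s00222-013-0448-1 p0218:L5] ⟶ Prop. 12.3.6 = the µ-transfer of ¶12.3.5
("the µ-invariant of `𝓛^{Σ,−}_{f,K,ξ}` is zero. That is, some `φ(a_i) ∈ A^×`" [p0202:L16–L29,
L52–L57]). STATUS OF THAT STEP (referee wording of record): at `p ≥ 5` — flag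
`SU14-12.3.6-mu@nonsplit` INFORMATIONAL (C2 R337.3 (β), verbatim): «informational: µ-transfer of
¶12.3.5/Prop 12.3.6 repaired in refereed print for p ≥ 5 — @Wan15-L87/T101 (repair printed inside
Wan's framework; F = ℚ transposition = INFERENCE, no authors' erratum) | independent cover Thm103 =
Thm 4 ⇐ [Fuj06, unpublished] + [BCS25] Hyp 3.1.1 (H1) (met for surjective ρ̄_{E,p}, hence on
RowC1's good branch and all A1 instances)» (Wan, Forum Math. Sigma 3 (2015): Thm. 86 "Assume
that p ⩾ 5", Lemma 87 ⇐ Remark 83 + Thm. 86, Thm. 101 / Thm. 103 "Suppose that p ⩾ 5"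
[corpus:paper:wan2015-iwasawa-main-conjecture-hilbert-modular-forms p0070:L5, p0071:L2–L14,
p0088:L30, p0089:L47, p0091:L42]); at `p = 3` — flag `SU14-12.3.6-mu@nonsplit@3`
**ACTIVE-PRINT-GAP** on BOTH branches of `_hred` (good ordinary `3` and multiplicative `3`;
R152.2 = R334 = R337, three independent desk readings): in S–U's proof the (ram) prime `q` is chosen
inert in `K` with `q ∈ Σ`, the `w ∣ q` factor of (12.3.5.b) is `(q² − 1)/q²`, and `3 ∣ q² − 1` for
every prime `q ≠ 3`, so the µ-sentence of Prop. 12.3.6 fails in EVERY `p = 3` instance; refereed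
repair at `3`: NONE located (Wan's Thm. 86 excludes `3` inside its proof; BCS IMRN 2025 is `p > 3`;
no S–U erratum; a non-[SU] road at `3` is announced only for `N` square-free — BSTW
arXiv:2409.01350v2 Thm. 10.10 (a) (zeta elements; Rem. 10.11), PRE, typed as the OPEN binder
`BurungaleSkinnerTianWan2024.thm1010a_mainStatement_semistable_ordinary_OPEN` (whose STATEMENT
already follows from `skinner_urban_main_conjecture`:
`BurungaleSkinnerTianWan2024.thm1010a_mainStatement_semistable_ordinary_OPEN_of_skinnerUrban`);
BSTW's own Thm. 9.21 (c) / Thm. 12.3 at `p = 3` run through [SU] Thm. 3.29 under (ram)).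
CONSUMERS AT 3:
route item stmt-BirchSwinnertonDyer-19381
`SkinnerRankZeroPPart := thmC_padicValRat_bsd_rank_zero` (Theses/ClassRecordThree.lean,
Theses/KolyvaginRoadThree.lean; child of 19112 / 19156) instantiates THIS fact at `p = 3`, `3 ‖ N`,
and `Rank1Residual.bsdp_three_of_L_one_ne_zero_of_ram` (RowC1 at `3`) at good-ordinary-or-
multiplicative `3` — all inside the printed range `3 ≤ p` —, so the flag TRAVELS with those uses
and is priced there by the C-desk / referee A (PUB at `p ≥ 5`, PUB\* at `p = 3`; no class is
created or deleted by the flag; the sibling 19066 family of ErratumRoadFive uses the fact at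
`5 ≤ p` only). RETIREMENT (R152.2 (g)): a refereed `p = 3` lower divisibility over `ℚ` — BSTW
journal version, an S–U erratum, or an `F = ℚ` Lemma-87 analogue without `p ⩾ 5`; typed
retirement-target family of record (CITED-FACTS-v2 §5 R-01; EXISTING decls, no new fact):
`skinner_urban_main_conjecture W 3` (good ordinary `3`; G1
`SkinnerUrban2014_thm369_cyclotomicMainConjecture_at_three` its corollary form, G2 = the S–U lower
half at `3` the item of record) ∥ `Skinner2016.thmA_charIdeal_multiplicative` at `p = 3`
(multiplicative `3`, item 19402). The same paragraph stands on the sibling clause (2)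
`thmC_one_le_selmerCorank_of_L_one_eq_zero` (file `SelmerCorankOfVanishingLValue`).
[cite: Skinner2016PacificMC, Thm. C (§1), footnote 1, §2.5] -/
def thmC_padicValRat_bsd_rank_zero : Prop :=
  ∀ (W : WeierstrassCurve ℚ) [W.IsElliptic] [W.IsGloballyMinimal] (p : ℕ) [Fact p.Prime]
    (_hp : 3 ≤ p)
    (_hred : (W.HasGoodReductionAtPrime p ∧ ¬ (p : ℤ) ∣ W.frobeniusTrace p) ∨
      W.HasMultiplicativeReductionAtPrime p)
    (_hirr : W.HasIrreducibleModPGaloisRep p)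
    (_hram : ∃ ℓ : ℕ, ∃ _ : Fact ℓ.Prime, ℓ ≠ p ∧ W.HasMultiplicativeReductionAtPrime ℓ ∧
      ¬ p ∣ padicValInt ℓ W.minimalDiscriminantInt)
    (_hL : W.entireLFunction 1 ≠ 0) (_hfin : Finite W.sha),
    ∃ q : ℚ, W.entireLFunction 1 / (W.realPeriodRat : ℂ) = (q : ℂ) ∧
      padicValRat p q = (padicValNat p W.shaOrder : ℤ) + padicValNat p W.tamagawaProduct -
        2 * padicValNat p W.torsionOrder

/-- Skinner 2016, Thm. C implies the tree's Skinner–Urban form bsd.S30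
(`Literature.NumberTheory.EllipticCurves.padicValRat_bsd_rank_zero`): at a good ordinary `p ≥ 3`
with (irr) + (ram), the extra hypothesis "`ρ̄_{E,p}` surjective" of S–U Thm. 2 (a) is simply not
used. [cite: Skinner2016PacificMC, Thm. C (§1)] -/
theorem padicValRat_bsd_rank_zero_of_thmC (h : thmC_padicValRat_bsd_rank_zero) :
    Literature.NumberTheory.EllipticCurves.padicValRat_bsd_rank_zero := by
  intro W _ _ p _ hp hgood hord hirr haux hL _hsurj hfin
  exact h W p hp (Or.inl ⟨hgood, hord⟩) hirr haux hL hfin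

end Literature.NumberTheory.EllipticCurves.Skinner2016

end
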